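import Summits.CriticalPhenomena.PercolationContinuityZ3.Theorems.PercNearOneGluingNoHeavyQuantFarGate3ChartCCertE
import HarnessLib

/-!
# QUANT lane R8, front "FAR beyond trees", layer one — THE DEGREE-THREE GATE AT THE OBSERVER, L-d: box-certificate kernel v4-IVd — SOUNDNESS `ChartC.sound`

builds on p205010 (kernel theorem, internal audit signed; external expert review pending)

Support file (`--supports stmt-CriticalPhenomena-4575`), seat `prim-quant-p1` (gen 32); memo
`run/shared/lean/prim/quant/prim-quant-p1-g32/FOR-LEAD-GATE3-CHARTC.md`.  Mathlib-only + earlier files of the chart-C box-certificate kernel;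
standard axioms; no sorries.  GENERATED by `work/chartc/gen_certes.py` (pattern of files XLIVc/XLIVd, one dimension up, no windows).

`ChartC.sound`: `check d = true` ⟹ the chart-C system (hypothesis `hC` of `Gate3.red8_of_chartC`, file XLVI) is infeasible at every
`(σ, u, r₁, r₂)` of the box with `0 < σ`, `0 < u`, `σu ≤ 1`, `0 ≤ r₁ ≤ r₂ < 1` — via `BoxPoly4.eval_nonpos_of_ctrl_int` (XLVII), `eval_polyOf` (L-c)
and the uniform engine `certCu` (L-a).
[this work].
-/

noncomputable section

namespace Summit.CriticalPhenomena.PercolationContinuityZ3.Theorems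

namespace Quant

namespace ChartC

open BoxPoly4 BoxCert


/-- **Soundness of the chart-C checker.**  A checked certificate refutes the chart-C system at every parameter point of its box (with
`0 < σ`, `0 < u`, `σu ≤ 1`, `0 ≤ r₁ ≤ r₂ < 1`). [this work] -/
theorem sound (d : Cert) (hchk : check d = true) (σ u r₁ r₂ : ℝ) (hσ0 : 0 < σ) (hu0 : 0 < u) (hσu : σ * u ≤ 1)
    (hr10 : 0 ≤ r₁) (hr12 : r₁ ≤ r₂) (hr2 : r₂ < 1)
    (hS0 : (d.S0 : ℝ) ≤ d.D * σ) (hS1 : (d.D : ℝ) * σ ≤ d.S1) (hT0 : (d.T0 : ℝ) ≤ d.D * u) (hT1 : (d.D : ℝ) * u ≤ d.T1)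
    (hU0 : (d.U0 : ℝ) ≤ d.D * (1 - r₁)) (hU1 : (d.D : ℝ) * (1 - r₁) ≤ d.U1) (hV0 : (d.V0 : ℝ) ≤ d.D * (1 - r₂)) (hV1 : (d.D : ℝ) * (1 - r₂) ≤ d.V1) :
    ∀ (a0 a1 A2 B1 B2 c0 c1 D : ℝ), 0 ≤ a0 → 0 ≤ a1 → 0 ≤ A2 → 0 ≤ B1 → 0 ≤ B2 → 0 ≤ c0 → 0 ≤ c1 → 0 ≤ D →
        B1 * (u * B2 + (c0 + c1)) ≤ σ * D * (a0 + a1 + σ * u * A2) →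
        B2 * (u * B1 + (c0 + c1)) ≤ σ * D * (a0 + a1 + σ * u * A2) →
        (c0 + c1) * (B1 + B2) ≤ σ * D * (a0 + a1 + σ * u * A2) →
        B1 * (a1 + σ * u * A2 + c1 + σ * u * D) ≤ σ * D * (a0 + u * B1 + u * B2 + c0) →
        B2 * (a1 + σ * u * A2 + c1 + σ * u * D) ≤ σ * D * (a0 + u * B1 + u * B2 + c0) →
        c0 * (a1 + σ * u * A2 + c1 + σ * u * D) ≤ (c1 + σ * u * D) * (a0 + u * B1 + u * B2 + c0) →
        0 < ((1 - r₁) * (1 - r₂)) * (a0 + c0) - (1 - σ * u) * A2 - (1 - σ * u) * ((1 - r₁) * (1 - r₂)) * D →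
        0 < (1 - σ * u) * (1 - r₁) * B1 - σ * (r₂ * (1 - r₁)) * a0 - σ * (1 - r₁) * a1 - σ * (1 - σ * u * r₁) * A2 - (1 - (1 - σ * u) * (1 - r₂)) * (1 - r₁) * B2 - σ * ((1 - r₁) * (1 - r₂)) * c1 →
        0 < (1 - σ * u) * (1 - r₂) * B2 - σ * (r₁ * (1 - r₂)) * a0 - σ * (1 - r₂) * a1 - σ * (1 - σ * u * r₂) * A2 - (1 - (1 - σ * u) * (1 - r₁)) * (1 - r₂) * B1 - σ * ((1 - r₁) * (1 - r₂)) * c1 →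
        0 < (1 - σ * u * max r₁ r₂ - σ * (1 - max r₁ r₂)) * a1 + (1 - σ * u * (r₁ + r₂ * (1 - r₁)) - σ * ((1 - r₁) * (1 - r₂))) * c1 - σ * (r₁ + r₂ * (1 - r₁) - max r₁ r₂) * a0 - ((1 - (1 - σ * u) * (1 - r₁)) * (1 - r₂)) * B1 - ((1 - (1 - σ * u) * (1 - r₂)) * (1 - r₁)) * B2 →
        0 < (σ * u * (1 + r₁ + r₂) + σ * max r₁ r₂ - 2) * a0 + (σ * u * (1 + r₁ + r₂) + σ * max r₁ r₂ - σ * u * max r₁ r₂ - 1) * a1 + σ * (σ * u * u * (1 + r₁ + r₂) + 1 - 2 * u) * A2 + ((1 - (1 - σ * u) * (1 - r₁)) * (u + r₂ * (1 + u)) - u) * B1 + ((1 - (1 - σ * u) * (1 - r₂)) * (u + r₁ * (1 + u)) - u) * B2 + (σ * u + (σ + 2 * (σ * u)) * (r₁ + r₂ * (1 - r₁)) - 2) * c0 + (σ * u + (σ + σ * u) * (r₁ + r₂ * (1 - r₁)) - 1) * c1 + (σ + σ * u - σ * u * ((1 - σ * u) * ((1 - r₁) * (1 - r₂)))) * D 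→
        False := by
  -- unpack the checker
  simp only [check, Bool.and_eq_true, decide_eq_true_eq, List.all_eq_true] at hchk
  obtain ⟨⟨⟨hbox, hent⟩, hposB⟩, hctrl⟩ := hchk
  obtain ⟨hD, -, -, -, -⟩ := hbox
  have hr11 : r₁ ≤ 1 := by linarith
  have hr21 : r₂ ≤ 1 := hr2.le
  have hr20 : 0 ≤ r₂ := hr10.trans hr12
  have hw1 : 0 < 1 - r₁ := by linarith
  have hw2 : 0 < 1 - r₂ := by linarith
  have hent' : ∀ e ∈ d.entries, entryOk e = true := hent
  apply certCu σ u r₁ r₂ hσ0.le hu0.le hσu hr10 hr11 hr20 hr21 (lamL d.entries σ u r₁ r₂) (nuL d.entries σ u r₁ r₂)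
    (lamL_nonneg d.entries σ u r₁ r₂ hσ0.le hu0.le hr11 hr21) (nuL_nonneg d.entries σ u r₁ r₂ hσ0.le hu0.le hr11 hr21)
  · -- positivity
    simp only [posOk, List.any_eq_true, decide_eq_true_eq] at hposB
    obtain ⟨e, he, hk4, hidx, hmu⟩ := hposB
    have hwt : 0 < wt e σ u r₁ r₂ := by
      unfold wt
      have := mval_pos e.mono σ u (1 - r₁) (1 - r₂) hσ0 hu0 hw1 hw2
      have hmu' : (0 : ℝ) < e.mu := by exact_mod_cast hmu
      positivity
    have hnn := lamL_nonneg d.entries σ u r₁ r₂ hσ0.le hu0.le hr11 hr21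
    have key : ∀ (i : Fin 5) (x : Fin 8), e.kind = i.val → e.idx = x.val → wt e σ u r₁ r₂ ≤ lamL d.entries σ u r₁ r₂ i x := by
      intro i x hi hx
      unfold lamL
      have hmem : wt e σ u r₁ r₂ ∈ (d.entries.map fun e' => if e'.kind = i.val ∧ e'.idx = x.val then wt e' σ u r₁ r₂ else 0) := by
        rw [List.mem_map]; exact ⟨e, he, by rw [if_pos ⟨hi, hx⟩]⟩
      apply List.single_le_sum _ _ hmem
      intro y hy
      rw [List.mem_map] at hy
      obtain ⟨e', -, rfl⟩ := hy
      split_ifs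
      · exact wt_nonneg e' σ u r₁ r₂ hσ0.le hu0.le hr11 hr21
      · exact le_rfl
    have h03 := hnn 0 3; have h13 := hnn 1 3; have h23 := hnn 2 3; have h33 := hnn 3 3; have h43 := hnn 4 3
    have h04 := hnn 0 4; have h14 := hnn 1 4; have h24 := hnn 2 4; have h34 := hnn 3 4; have h44 := hnn 4 4
    interval_cases hk : e.kind <;> rcases hidx with hx | hx
    all_goals first
      | (have := key 0 3 rfl hx; linarith) | (have := key 0 4 rfl hx; linarith)
      | (have := key 1 3 rfl hx; linarith) | (have := key 1 4 rfl hx; linarith)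
      | (have := key 2 3 rfl hx; linarith) | (have := key 2 4 rfl hx; linarith)
      | (have := key 3 3 rfl hx; linarith) | (have := key 3 4 rfl hx; linarith)
      | (have := key 4 3 rfl hx; linarith) | (have := key 4 4 rfl hx; linarith)
  · -- the 36 conditions
    intro c c' hle
    have hge : c.val ≤ c'.val := hle
    have hcc := hctrl c (List.mem_finRange c) c' (List.mem_finRange c')
    simp only [Bool.or_eq_true, decide_eq_true_eq] at hcc
    rcases hcc with hbad | hnp
    · exact absurd hbad (not_lt.2 hge)
    · rw [V81.nonpos_iff, V81.toP4_ctrl, toP4_polyOfV d c c'] at hnp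
      have hev := eval_nonpos_of_ctrl_int (d.S0 : ℤ) d.S1 d.T0 d.T1 d.U0 d.U1 d.V0 d.V1 d.D (polyOf d c c') (by exact_mod_cast hD) hnp
        σ u (1 - r₁) (1 - r₂)
        (by push_cast; linarith) (by push_cast; linarith) (by push_cast; linarith) (by push_cast; linarith)
        (by push_cast; linarith) (by push_cast; linarith) (by push_cast; linarith) (by push_cast; linarith)
      rw [eval_polyOf d hent' c c' σ u r₁ r₂ hr12] at hev
      exact hev


end ChartC

end Quant

end Summit.CriticalPhenomena.PercolationContinuityZ3.Theorems
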